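import Literature.Geometry.Lorentzian.CauchyDevelopment
import Literature.Geometry.Lorentzian.NullInfinity
import Literature.Geometry.Lorentzian.FinalState

/-!
# Clause (ii) of K3 is gauge invariant (registered stub `stub_tameOuterPrecompIff`,
line `Sketch` = unwind-the-threshold-from-scri, crux `PhotonSphereChannels.TameCensorship`,
item stmt-FinalStateConjecture-17431)

Re-indexing the data hypersurface of a Cauchy development `𝒟 = (M, g, τ, ι, ν)` of a datum on `X`
by a homeomorphism `Φ` of `X` — embedding `ι ∘ Φ`, normal `ν ∘ Φ`, the SAME spacetime — does not
change clause (ii) of K3 ("`C³`-bounded outer geometry at a uniform scale"): the outer region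
`J⁺(range ι) ∩ {q | q ∈ I⁻(γ[0, ∞)) for a future complete normalised null ray γ from the data}`
is literally the same set for `(ι ∘ Φ, ν ∘ Φ)` and for `(ι, ν)`, because
`range (ι ∘ Φ) = range ι` (`Φ` is surjective) and a normalised null ray from `p` for
`(ι ∘ Φ, ν ∘ Φ)` is, by definition (`LorentzianMetric.IsNormalisedNullRayFrom` mentions `p` only
through `ι p` and `ν p`), a normalised null ray from `Φ p` for `(ι, ν)`; everything after
`∀ q ∈ outer` reads the spacetime only. This is the clause-(ii) companion of the tree's
`LorentzianMetric.hasCompleteFutureNullInfinity_comp_homeomorph` (clause (a),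
`CauchyDevelopmentPrecomp.lean`), consumed by the line's `tameOuter_precomp_iff`.
Stub-worker of the line lead prover-line-stmt-FinalStateConjecture-17431-0, 2026-08-17.
-/

-- the summit-side namespace `Summit.FinalStateConjecture.FinalStateConjecture.…` (summit = problem)
-- repeats a component by design, which the `dupNamespace` linter would flag on every decl.
set_option linter.dupNamespace false

open Literature.Geometry.Lorentzian
open scoped Manifold ContDiff Topology
open Filter Set Function

namespace Summit.FinalStateConjecture.FinalStateConjecture.Theorems.PhotonSphereChannels.TameCensorshipUnwind

/-- The set of points in the chronological past of a future complete normalised null ray from the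
data is unchanged by re-indexing the data hypersurface along a surjection `φ : Y' → Y`
(embedding `ι ∘ φ`, normal `u ↦ N (φ u)`): a normalised null ray from `p` for `(ι ∘ φ, N ∘ φ)` is
by definition a normalised null ray from `φ p` for `(ι, N)`, and every point of `Y` is a `φ p`. -/
private theorem setOf_completeRayPast_comp_eq {E : Type*} [NormedAddCommGroup E] [NormedSpace ℝ E]
    {H : Type*} [TopologicalSpace H] {I : ModelWithCorners ℝ E H} {M : Type*} [TopologicalSpace M]
    [ChartedSpace H M] [IsManifold I ∞ M] {Y Y' : Type*} (g : LorentzianMetric I ∞ M)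
    [FiniteDimensional ℝ E] [CompleteSpace E] [g.HasLeviCivita] (τ : TimeOrientation g)
    (ι : Y → M) (N : NormalField I ι) {φ : Y' → Y} (hφ : Surjective φ) :
    {q | ∃ (p : Y') (γ : ℝ → M) (dom : Set ℝ),
        g.IsNormalisedNullRayFrom τ (ι ∘ φ) (fun u => N (φ u)) p γ dom ∧ ¬ BddAbove dom ∧
          q ∈ g.chronologicalPast τ (γ '' (dom ∩ Set.Ici 0))} =
      {q | ∃ (p : Y) (γ : ℝ → M) (dom : Set ℝ),
        g.IsNormalisedNullRayFrom τ ι N p γ dom ∧ ¬ BddAbove dom ∧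
          q ∈ g.chronologicalPast τ (γ '' (dom ∩ Set.Ici 0))} := by
  ext q
  constructor
  · rintro ⟨p, γ, dom, hγ, hdom, hq⟩
    exact ⟨φ p, γ, dom, hγ, hdom, hq⟩
  · rintro ⟨p, γ, dom, hγ, hdom, hq⟩
    obtain ⟨p, rfl⟩ := hφ p
    exact ⟨p, γ, dom, hγ, hdom, hq⟩

/-- **Clause (ii) of K3 is gauge invariant** (registered stub `stub_tameOuterPrecompIff` of the
line `Sketch` of the crux `PhotonSphereChannels.TameCensorship`): re-indexing the data
hypersurface of a Cauchy development by a homeomorphism `Φ` of `Σ` (embedding `ι ∘ Φ`, normal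
`ν ∘ Φ`, same spacetime) does not change clause (ii), since the outer region is the same set:
`range (ι ∘ Φ) = range ι` (`Function.Surjective.range_comp`) and the normalised rays from `p` for
`(ι ∘ Φ, ν ∘ Φ)` are the rays from `Φ p` for `(ι, ν)` (`setOf_completeRayPast_comp_eq`); the rest
of the clause reads the spacetime only. Companion of the tree's
`LorentzianMetric.hasCompleteFutureNullInfinity_comp_homeomorph` (clause (a)). -/
theorem stub_tameOuterPrecompIff :
    ∀ (X : Type) [TopologicalSpace X] [ChartedSpace E3 X] [IsManifold (𝓡 3) ∞ X] [ConnectedSpace X]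
      (D : InitialDataSet (𝓡 3) X) (𝒟 : CauchyDevelopment D) (Φ : X ≃ₜ X),
      (∀ [𝒟.metric.HasLeviCivita],
        let outer : Set 𝒟.carrier :=
          𝒟.metric.causalFuture 𝒟.timeOrientation (Set.range (𝒟.embed ∘ Φ)) ∩
            {q | ∃ (p : X) (γ : ℝ → 𝒟.carrier) (dom : Set ℝ),
              𝒟.metric.IsNormalisedNullRayFrom 𝒟.timeOrientation (𝒟.embed ∘ Φ)
                  (fun u => 𝒟.normal (Φ u)) p γ dom ∧
                ¬ BddAbove dom ∧
                  q ∈ 𝒟.metric.chronologicalPast 𝒟.timeOrientation (γ '' (dom ∩ Set.Ici 0))}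
        ∃ r₀ : ℝ, 0 < r₀ ∧ ∃ Λ : NNReal, ∀ q ∈ outer,
          let U : TopologicalSpace.Opens E4 := ⟨Metric.ball (0 : E4) r₀, Metric.isOpen_ball⟩
          ∃ Ψ : U → 𝒟.carrier,
            𝒟.toSpacetime.IsLateChart (Minkowski.backgroundOn U) Set.univ (-r₀) Ψ ∧
              (∃ x : U, (x : E4) = 0 ∧ Ψ x = q) ∧
                supCkENorm (U : Set E4) 3
                    (𝒟.toSpacetime.deviationExtend (Minkowski.backgroundOn U) Ψ) ≤ (Λ : ENNReal) ∧
                  supCkENorm (U : Set E4) 0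
                    (𝒟.toSpacetime.deviationExtend (Minkowski.backgroundOn U) Ψ) ≤ 1 / 2) ↔
      (∀ [𝒟.metric.HasLeviCivita],
        let outer : Set 𝒟.carrier :=
          𝒟.metric.causalFuture 𝒟.timeOrientation (Set.range 𝒟.embed) ∩
            {q | ∃ (p : X) (γ : ℝ → 𝒟.carrier) (dom : Set ℝ),
              𝒟.metric.IsNormalisedNullRayFrom 𝒟.timeOrientation 𝒟.embed 𝒟.normal p γ dom ∧
                ¬ BddAbove dom ∧
                  q ∈ 𝒟.metric.chronologicalPast 𝒟.timeOrientation (γ '' (dom ∩ Set.Ici 0))}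
        ∃ r₀ : ℝ, 0 < r₀ ∧ ∃ Λ : NNReal, ∀ q ∈ outer,
          let U : TopologicalSpace.Opens E4 := ⟨Metric.ball (0 : E4) r₀, Metric.isOpen_ball⟩
          ∃ Ψ : U → 𝒟.carrier,
            𝒟.toSpacetime.IsLateChart (Minkowski.backgroundOn U) Set.univ (-r₀) Ψ ∧
              (∃ x : U, (x : E4) = 0 ∧ Ψ x = q) ∧
                supCkENorm (U : Set E4) 3
                    (𝒟.toSpacetime.deviationExtend (Minkowski.backgroundOn U) Ψ) ≤ (Λ : ENNReal) ∧
                  supCkENorm (U : Set E4) 0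
                    (𝒟.toSpacetime.deviationExtend (Minkowski.backgroundOn U) Ψ) ≤ 1 / 2) := by
  intro X _ _ _ _ D 𝒟 Φ
  constructor
  · intro h inst
    have h' := @h inst
    rw [Φ.surjective.range_comp,
      setOf_completeRayPast_comp_eq 𝒟.metric 𝒟.timeOrientation 𝒟.embed 𝒟.normal Φ.surjective]
      at h'
    exact h'
  · intro h inst
    have h' := @h inst
    rw [Φ.surjective.range_comp,
      setOf_completeRayPast_comp_eq 𝒟.metric 𝒟.timeOrientation 𝒟.embed 𝒟.normal Φ.surjective]
    exact h'

end Summit.FinalStateConjecture.FinalStateConjecture.Theorems.PhotonSphereChannels.TameCensorshipUnwind
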